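import Summits.ResolutionOfSingularities.ResolutionOfSingularities.Theorems.EquisingularLiftEquisingularLiftNatEquinodalCoreSOfCores
import Summits.ResolutionOfSingularities.ResolutionOfSingularities.Theorems.EquisingularLiftEquisingularLiftNatNDProjChart
import HarnessLib

/-!
# [OURS · L1 W4.5(b) · EL♮(3) · door ν4 «EQUINODAL PLANAR NOSE», brick N-0 (JINIT), core S7 — part 1] COORDINATE VECTORS AND THE STANDARD CHART OF `ℙⁿ_k`
# `eq_of_isCoordVecOf` · `isCoordVecOf_of_section` · `isCoordVecOf_chartι` (k-side dictionary for core S7 «←»)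

res-type-027 g22 (desk WORD g25-5 «CORES SPLIT», default `027 ↔ S7`; g25-10).  OURS; NOT a statement of any manuscript ([Hironaka2017] is a candidate under
adjudication, nothing of it is asserted); AI-written, weaker than expert review.  No `sorry`; standard axioms; DEF-FREE.
`--supports stmt-ResolutionOfSingularities-20148 --as helper`, counted 0.  EL♮(3) is NOT proved here; resolution in positive characteristic is NOT proved.

WHAT (all about res-L1-w45b-nose-w1's `IsCoordVecOf k n w y` of …NatResidueHypDefsE — «`w` is a homogeneous coordinate vector of the point `y`»):
* `eq_of_isCoordVecOf` — two points with a common coordinate vector coincide (a relevant homogeneous prime is determined by its homogeneous members;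
  `Ideal.IsHomogeneous.mem_iff`);
* `exists_homogeneous_lift`, `map_eval_eq` — forms lift along `θ : O ↠ k`, `θ(F(a)) = (θF)(θ ∘ a)`;
* ★ `isCoordVecOf_of_section` — if `Proj φ w = [a] 𝔪` for the `O`-point `[a]` of ✓ `SectionOfVec` (`a d = 1`), then `θ ∘ a` is a coordinate vector of `w`
  (`f ∈ 𝔭_w ↔ w ∈ supp (f)~ ↔ Proj φ w ∈ supp (F)~ ↔ F(a) ∈ 𝔪_O ↔ f(θ ∘ a) = 0`, by ✓ `CILift.support_projIdealSheaf_span`, ✓ `CILift.comap_projIdealSheaf_span`,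
  ✓ (S-dict) `SectionOfVec.sectionOfVec_closedPoint_mem_support_iff`) — this is how core S7 locates the marked point `w i`;
* `mem_asHomogeneousIdeal_iff_of_isHomogeneous_zero`, ★ `isCoordVecOf_chartι` — the chart point `chartι k n d 𝔪_b` has the coordinate vector `(b, 1 in slot d)`
  (✓ `ND.mem_asHomogeneousIdeal_chartι_iff` + Literature ✓ `ProjectiveSpace.eval_dehomogenize`).
(The «→» half of S7 is nose-w1's ✓ `eq_marked_point_of_isCoordVecOf`, p686960; nothing here restates it.)
[cite: Hartshorne1977, II Prop. 2.5 and Prop. 5.9] [folklore]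
-/

set_option linter.dupNamespace false -- mandated namespace `Summit.<Summit>.<Problem>` of this single-conjunct summit
set_option linter.overlappingInstances false -- signatures carry `[IsDomain O] [IsDiscreteValuationRing O]`

noncomputable section

open CategoryTheory CategoryTheory.Limits AlgebraicGeometry TopologicalSpace Topology IsLocalRing
open MvPolynomial
open Literature.AlgebraicGeometry.Resolution
open AlgebraicGeometry.Scheme.IdealSheafData

namespace Summit.ResolutionOfSingularities.ResolutionOfSingularities.Cruxes.EquisingularLiftNat.Sections.Equinodal

/-! ## §1 Coordinate vectors of points of `ℙⁿ_k` -/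

section CoordVec

variable {k : Type} [Field k] {n : ℕ}

/-- **Two points of `ℙⁿ_k` with a common coordinate vector coincide**: a relevant homogeneous prime is determined by its homogeneous members.
[folklore] -/
theorem eq_of_isCoordVecOf {w : Fin (n + 1) → k} {y y' : (Literature.AlgebraicGeometry.Motives.projectiveSpace n k).left}
    (hy : IsCoordVecOf k n w y) (hy' : IsCoordVecOf k n w y') : y = y' := by
  letI := MvPolynomial.gradedAlgebra (σ := Fin (n + 1)) (R := k)
  apply ProjectiveSpectrum.ext
  apply HomogeneousIdeal.toIdeal_injective
  ext f
  rw [(y : ProjectiveSpectrum (homogeneousSubmodule (Fin (n + 1)) k)).asHomogeneousIdeal.isHomogeneous.mem_iff,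
    (y' : ProjectiveSpectrum (homogeneousSubmodule (Fin (n + 1)) k)).asHomogeneousIdeal.isHomogeneous.mem_iff]
  refine forall_congr' fun i => ?_
  have hfi : ((DirectSum.decompose (homogeneousSubmodule (Fin (n + 1)) k) f i : MvPolynomial (Fin (n + 1)) k)).IsHomogeneous i :=
    (DirectSum.decompose (homogeneousSubmodule (Fin (n + 1)) k) f i).2
  change (_ : MvPolynomial (Fin (n + 1)) k) ∈ (y : ProjectiveSpectrum (homogeneousSubmodule (Fin (n + 1)) k)).asHomogeneousIdeal ↔
    (_ : MvPolynomial (Fin (n + 1)) k) ∈ (y' : ProjectiveSpectrum (homogeneousSubmodule (Fin (n + 1)) k)).asHomogeneousIdeal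
  rw [hy i _ hfi, hy' i _ hfi]

end CoordVec

/-! ## §2 Homogeneous lifts along `θ : O ↠ k` -/

section Lift

variable {O k : Type} [CommRing O] [Field k] (θ : O →+* k) (hθ : Function.Surjective θ) {n : ℕ}

include hθ in
/-- A form of degree `d` over `k` lifts to a form of degree `d` over `O`. [folklore] -/
theorem exists_homogeneous_lift {d : ℕ} (f : MvPolynomial (Fin (n + 1)) k) (hf : f.IsHomogeneous d) :
    ∃ F : MvPolynomial (Fin (n + 1)) O, F.IsHomogeneous d ∧ MvPolynomial.map θ F = f := by
  classical
  refine ⟨∑ m ∈ f.support, monomial m (Function.surjInv hθ (coeff m f)), ?_, ?_⟩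
  · refine IsHomogeneous.sum _ _ _ fun m hm => ?_
    refine isHomogeneous_monomial _ ?_
    rw [Finsupp.degree_eq_weight_one]
    exact hf (mem_support_iff.mp hm)
  · rw [map_sum]
    simp only [map_monomial, Function.surjInv_eq hθ]
    exact (as_sum f).symm

/-- `θ (F(a)) = (θ F)(θ ∘ a)`. [folklore] -/
theorem map_eval_eq (F : MvPolynomial (Fin (n + 1)) O) (a : Fin (n + 1) → O) :
    θ (eval a F) = eval (fun j => θ (a j)) (MvPolynomial.map θ F) := by
  induction F using MvPolynomial.induction_on with
  | C c => simp
  | add p q hp hq => simp [hp, hq]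
  | mul_X p s hp => simp [hp]

end Lift

/-! ## §3 The coordinate vector of a marked closed point `w`: `Proj φ w = [a] 𝔪` ⇒ `θ ∘ a` are coordinates of `w` -/

section SectionPoint

variable {O k : Type} [CommRing O] [IsLocalRing O] [Field k] (θ : O →+* k) (hθ : Function.Surjective θ) {n : ℕ}

include hθ in
/-- **THE REDUCTION OF AN `O`-POINT.**  If the closed point `w` of `ℙⁿ_k` is carried by `Proj φ` (`φ = map θ`) onto the closed point of the
section `[a]` (`a d = 1`, ✓ SectionOfVec), then `θ ∘ a` is a homogeneous coordinate vector of `w`. [cite: Hartshorne1977, II Prop. 5.9] -/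
theorem isCoordVecOf_of_section :
    letI := MvPolynomial.gradedAlgebra (σ := Fin (n + 1)) (R := O)
    letI := MvPolynomial.gradedAlgebra (σ := Fin (n + 1)) (R := k)
    ∀ (φ : homogeneousSubmodule (Fin (n + 1)) O →+*ᵍ homogeneousSubmodule (Fin (n + 1)) k)
      (hφ' : HomogeneousIdeal.irrelevant (homogeneousSubmodule (Fin (n + 1)) k) ≤ (HomogeneousIdeal.irrelevant (homogeneousSubmodule (Fin (n + 1)) O)).map φ),
      (∀ s, φ s = MvPolynomial.map θ s) →
    ∀ (a : Fin (n + 1) → O) (d : Fin (n + 1)) (ha : a d = 1) (w : Proj (homogeneousSubmodule (Fin (n + 1)) k)),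
      (Proj.map φ hφ' : Proj (homogeneousSubmodule (Fin (n + 1)) k) ⟶ Proj (homogeneousSubmodule (Fin (n + 1)) O)) w =
        (Spec.map (CommRingCat.ofHom ((Localization.awayLift (MvPolynomial.eval a) (X d : MvPolynomial (Fin (n + 1)) O)
            (SectionOfVec.isUnit_eval_X a d ha)).comp
          (algebraMap (HomogeneousLocalization.Away (homogeneousSubmodule (Fin (n + 1)) O) (X d : MvPolynomial (Fin (n + 1)) O))
            (Localization.Away (X d : MvPolynomial (Fin (n + 1)) O))))) ≫
          Proj.awayι (homogeneousSubmodule (Fin (n + 1)) O) (X d) (isHomogeneous_X O d) one_pos) (closedPoint O) →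
      IsCoordVecOf k n (fun j => θ (a j)) w := by
  letI := MvPolynomial.gradedAlgebra (σ := Fin (n + 1)) (R := O)
  letI := MvPolynomial.gradedAlgebra (σ := Fin (n + 1)) (R := k)
  intro φ hφ' hφ a d ha w hw d' f hf
  have hφX : ∀ i : Fin (n + 1), φ (X i) = X i := fun i => by rw [hφ, map_X]
  by_cases hf0 : f = 0
  · subst hf0; simp
  rcases Nat.eq_zero_or_pos d' with rfl | hd'
  · -- degree zero: a non-zero constant is a unit, outside the relevant prime
    have htot : f.totalDegree = 0 := hf.totalDegree hf0
    obtain ⟨hfC⟩ : f = C (coeff 0 f) ∧ True := ⟨totalDegree_eq_zero_iff_eq_C.mp htot, trivial⟩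
    have hc0 : coeff 0 f ≠ 0 := fun h => hf0 (by rw [hfC, h, C_0])
    rw [hfC, eval_C]
    constructor
    · intro hmem
      exfalso
      have hunit : IsUnit (C (coeff 0 f) : MvPolynomial (Fin (n + 1)) k) := (isUnit_iff_ne_zero.mpr hc0).map C
      exact (w : ProjectiveSpectrum (homogeneousSubmodule (Fin (n + 1)) k)).isPrime.ne_top
        (Ideal.eq_top_of_isUnit_mem _ hmem hunit)
    · intro h; exact absurd h hc0
  -- positive degree: lift `f` to a form `F` over `O` and read the support dictionary of the section
  obtain ⟨F, hF, hFf⟩ := exists_homogeneous_lift θ hθ f hf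
  have hF' : ∀ l, (![F] : Fin 1 → MvPolynomial (Fin (n + 1)) O) l ∈ homogeneousSubmodule (Fin (n + 1)) O ((![d'] : Fin 1 → ℕ) l) := by
    intro l; fin_cases l; exact hF
  have hf' : ∀ l, (![f] : Fin 1 → MvPolynomial (Fin (n + 1)) k) l ∈ homogeneousSubmodule (Fin (n + 1)) k ((![d'] : Fin 1 → ℕ) l) := by
    intro l; fin_cases l; exact hf
  have hφF : ∀ l, φ ((![F] : Fin 1 → MvPolynomial (Fin (n + 1)) O) l) = (![f] : Fin 1 → MvPolynomial (Fin (n + 1)) k) l := by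
    intro l; fin_cases l; change φ F = f; rw [hφ, hFf]
  -- `f ∈ 𝔭_w ↔ w ∈ supp (f)~`
  have h1 : f ∈ (w : ProjectiveSpectrum (homogeneousSubmodule (Fin (n + 1)) k)).asHomogeneousIdeal ↔
      w ∈ ((projIdealSheaf (homogeneousSubmodule (Fin (n + 1)) k)
        ⟨Ideal.span (Set.range ![f]), isHomogeneous_span_of_forall_mem _ _ _ hf'⟩).support : Set (Proj (homogeneousSubmodule (Fin (n + 1)) k))) := by
    rw [CILift.support_projIdealSheaf_span ![f] ![d'] hf']
    simp only [Set.mem_setOf_eq, Fin.forall_fin_one, Matrix.cons_val_zero]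
  -- base change: `(F)~ · 𝒪_{ℙⁿ_k} = (f)~`
  have h2 : w ∈ ((projIdealSheaf (homogeneousSubmodule (Fin (n + 1)) k)
        ⟨Ideal.span (Set.range ![f]), isHomogeneous_span_of_forall_mem _ _ _ hf'⟩).support : Set (Proj (homogeneousSubmodule (Fin (n + 1)) k))) ↔
      (Proj.map φ hφ' : Proj (homogeneousSubmodule (Fin (n + 1)) k) ⟶ Proj (homogeneousSubmodule (Fin (n + 1)) O)) w ∈
        ((projIdealSheaf (homogeneousSubmodule (Fin (n + 1)) O)
          ⟨Ideal.span (Set.range ![F]), isHomogeneous_span_of_forall_mem _ _ _ hF'⟩).support : Set (Proj (homogeneousSubmodule (Fin (n + 1)) O))) := by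
    rw [← CILift.comap_projIdealSheaf_span φ hφ' hφX ![F] ![f] ![d'] hF' hf' hφF, Scheme.IdealSheafData.support_comap]
    rfl
  -- the support dictionary of the section
  have h3 := SectionOfVec.sectionOfVec_closedPoint_mem_support_iff a d ha ![F] ![d'] hF'
  rw [h1, h2, hw]
  refine h3.trans ?_
  simp only [Fin.forall_fin_one, Matrix.cons_val_zero]
  rw [← ker_eq_maximalIdeal_of_surjective θ hθ, RingHom.mem_ker, map_eval_eq θ F a, hFf]

end SectionPoint


/-! ## §4 The chart point with prescribed rational coordinates -/

section ChartPoint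

variable {k : Type} [Field k] {n : ℕ}

/-- A form of degree `0` lies in a relevant homogeneous prime iff it is `0` iff it vanishes at any vector. [folklore] -/
theorem mem_asHomogeneousIdeal_iff_of_isHomogeneous_zero :
    letI := MvPolynomial.gradedAlgebra (σ := Fin (n + 1)) (R := k)
    ∀ (y : Proj (homogeneousSubmodule (Fin (n + 1)) k)) {f : MvPolynomial (Fin (n + 1)) k}, f.IsHomogeneous 0 →
      ∀ (w : Fin (n + 1) → k), f ∈ y.asHomogeneousIdeal ↔ eval w f = 0 := by
  letI := MvPolynomial.gradedAlgebra (σ := Fin (n + 1)) (R := k)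
  intro y f hf w
  by_cases hf0 : f = 0
  · subst hf0; simp
  have htot : f.totalDegree = 0 := hf.totalDegree hf0
  have hfC : f = C (coeff 0 f) := totalDegree_eq_zero_iff_eq_C.mp htot
  have hc0 : coeff 0 f ≠ 0 := fun h => hf0 (by rw [hfC, h, C_0])
  rw [hfC, eval_C]
  constructor
  · intro hmem
    exfalso
    have hunit : IsUnit (C (coeff 0 f) : MvPolynomial (Fin (n + 1)) k) := (isUnit_iff_ne_zero.mpr hc0).map C
    exact y.isPrime.ne_top (Ideal.eq_top_of_isUnit_mem _ hmem hunit)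
  · intro h; exact absurd h hc0

/-- **The chart point over the rational point `b` has the coordinate vector `(b₁, …, 1, …, bₙ)`** (`1` in slot `d`). [cite: Hartshorne1977, II Prop. 2.5] -/
theorem isCoordVecOf_chartι (d : Fin (n + 1)) (b : Fin n → k) (y₀ : Spec (CommRingCat.of (MvPolynomial (Fin n) k)))
    (hy₀ : y₀.asIdeal = MvPolynomial.vanishingIdeal k {b}) :
    IsCoordVecOf k n (Fin.insertNth d 1 b) (Literature.AlgebraicGeometry.Motives.ProjectiveSpaceCells.chartι k n d y₀) := by
  letI := MvPolynomial.gradedAlgebra (σ := Fin (n + 1)) (R := k)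
  intro m f hf
  rcases Nat.eq_zero_or_pos m with rfl | hm
  · exact mem_asHomogeneousIdeal_iff_of_isHomogeneous_zero _ hf _
  have hb : (fun j => Fin.insertNth (α := fun _ => k) d 1 b (d.succAbove j)) = b := by
    funext j; simp
  change f ∈ ((Literature.AlgebraicGeometry.Motives.ProjectiveSpaceCells.chartι k n d y₀ : Proj (homogeneousSubmodule (Fin (n + 1)) k)) :
      ProjectiveSpectrum (homogeneousSubmodule (Fin (n + 1)) k)).asHomogeneousIdeal ↔ _
  rw [ND.mem_asHomogeneousIdeal_chartι_iff k n d hm hf y₀, hy₀, MvPolynomial.mem_vanishingIdeal_singleton_iff]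
  change eval b (Literature.AlgebraicGeometry.Motives.ProjectiveSpace.dehomogenize k d f) = 0 ↔ _
  rw [← Literature.AlgebraicGeometry.Motives.ProjectiveSpace.eval_dehomogenize d (Fin.insertNth d 1 b) (by simp) f, hb]

end ChartPoint

end Summit.ResolutionOfSingularities.ResolutionOfSingularities.Cruxes.EquisingularLiftNat.Sections.Equinodal

end
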